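import Literature.NumberTheory.DiophantineApproximation.PolylogTwoPointHermitePadeBricks
import Literature.NumberTheory.DiophantineApproximation.DilogHermitePadeArithmetic
import HarnessLib

/-!
# Type-I Hermite–Padé forms for `1, Li_s(1/N), Li_s(−1/N)` (`s ≤ w`) — the partial fraction expansion

Topic `Literature/NumberTheory/DiophantineApproximation`. For the weight-`w` PARITY kernel
`K^{(w)}_n(u) = 4^{wn} (u − wn + 1)_{wn} / (2u+1)_{n+1}^w` (`ParityPade.kernelH`, vocabulary in
`PolylogTwoPointHermitePade.lean`; the parity reduction of David–Hirata-Kohno–Kawashima 2020, Thm 2.1,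
at the two points `±1/N`) we prove, in the doubled variable `t = 2u`,

* `kernelH_eq_prod_brickEval`: `K^{(w)}_n(u) = ∏_{s<w} B_s(2u)` is the product of the `w` parity bricks
  `B_s(t) = 4^n (t/2 − (s+1)n + 1)_n/(t+1)_{n+1} = ∑_m (resP n s m)/(t+m+1)`
  (`ParityPade.brick_eq_brickEval`; the numerator identity is `BallRivoal.poch_mul` reindexed by
  `L ↦ w − 1 − s`, together with `4^{wn} = ∏_{s<w} 4^n`);
* `exists_pf_kernelH`: hence (`BallRivoal.exists_pf_prod` with `d = d_n = lcm(1, …, n)`) there are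
  rationals `c_{o,p}` (`o < w`, `p ≤ n`) with
  `K^{(w)}_n(u) = ∑_{p ≤ n} ∑_{o<w} c_{o,p}/(2u+p+1)^{o+1}` away from the poles,
  `d_n^{w−1−o} c_{o,p} ∈ ℤ` and `∑ |c_{o,p}| ≤ w! ∏_{s<w} 2^{(2s+5)n+1}`.

This is the two-point counterpart of `PolylogHermitePadeExpansion.lean`
(`PolylogPade.kernelW_eq_prod_brickEval`, `PolylogPade.exists_pf_kernelW`). Everything is PROVED; no
definitions, no named facts.

References: S. David, N. Hirata-Kohno, M. Kawashima, *Can polylogarithms at algebraic points be linearly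
independent?*, Moscow J. Comb. Number Th. 9 (2020) 389–406, Thm 2.1 [DavidHirataKohnoKawashima2020];
T. Rivoal, C. R. Acad. Sci. Paris 331 (2000), §2 proof of Lemme 5 (the bricks and their partial
fractions) [Rivoal2000].
-/

open Finset

namespace Literature.NumberTheory.DiophantineApproximation

namespace ParityPade

open Literature.NumberTheory.Transcendental

/-- **The parity kernel is the product of its bricks**: for `2u ∉ {−1, …, −(n+1)}`,
`K^{(w)}_n(u) = ∏_{s<w} B_s(2u)` with `B_s(t) = ∑_m (resP n s m)/(t+m+1) = 4^n (t/2 − (s+1)n + 1)_n/(t+1)_{n+1}`,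
since `(u − wn + 1)_{wn} = ∏_{s<w} (u − (s+1)n + 1)_n` (`BallRivoal.poch_mul`, reindexed by
`s ↦ w − 1 − s`) and `4^{wn} = ∏_{s<w} 4^n`. [cite: DavidHirataKohnoKawashima2020, Thm 2.1] -/
theorem kernelH_eq_prod_brickEval (w n : ℕ) (u : ℚ) (hu : ∀ m, m ≤ n → 2 * u + m + 1 ≠ 0) :
    kernelH w n u = ∏ s ∈ Finset.range w, BallRivoal.brickEval n (resP n s) (2 * u) := by
  have hpoch : BallRivoal.poch (2 * u + 1) (n + 1) ≠ 0 := by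
    rw [BallRivoal.poch]
    exact prod_ne_zero_iff.2 fun m hm => by
      have := hu m (Nat.lt_succ_iff.1 (mem_range.1 hm))
      intro h
      apply this
      linarith
  have hDr : BallRivoal.poch (2 * u + 1) (n + 1) ^ w =
      ∏ _L ∈ range w, BallRivoal.poch (2 * u + 1) (n + 1) := by
    rw [prod_const, card_range]
  have h4 : (4 : ℚ) ^ (w * n) = ∏ _L ∈ range w, (4 : ℚ) ^ n := by
    rw [prod_const, card_range, ← pow_mul, mul_comm]
  have hF : ∏ L ∈ range w, BallRivoal.brickEval n (resP n L) (2 * u) =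
      4 ^ (w * n) * BallRivoal.poch (u - w * n + 1) (w * n) /
        BallRivoal.poch (2 * u + 1) (n + 1) ^ w := by
    rw [eq_div_iff (pow_ne_zero _ hpoch), BallRivoal.poch_mul, h4, hDr, ← prod_mul_distrib,
      ← prod_mul_distrib]
    conv_rhs => rw [← prod_range_reflect]
    refine prod_congr rfl fun L hL => ?_
    have hL' : L < w := mem_range.1 hL
    rw [← brick_eq_brickEval n L (2 * u) hu, div_mul_cancel₀ _ hpoch]
    congr 2
    rw [Nat.cast_sub (by omega : L ≤ w - 1), Nat.cast_sub (by omega : 1 ≤ w)]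
    push_cast
    ring
  rw [hF, kernelH]

/-- **Partial fractions of the parity kernel**: for `1 ≤ w` there are rationals `c_{o,p}`
(`o < w`, `p ≤ n`) with `K^{(w)}_n(u) = ∑_{p ≤ n} ∑_{o<w} c_{o,p}/(2u+p+1)^{o+1}` for
`2u ∉ {−1, …, −(n+1)}`, `d_n^{w−1−o} c_{o,p} ∈ ℤ` (`d_n = lcm(1, …, n)`), and
`∑ |c_{o,p}| ≤ w! ∏_{s<w} 2^{(2s+5)n+1}` — `BallRivoal.exists_pf_prod` applied to the parity bricks of
`kernelH_eq_prod_brickEval`, with `∑_m |resP n s m| ≤ 2^{(2s+5)n+1}` (`sum_abs_resP_le`).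
[cite: DavidHirataKohnoKawashima2020, Thm 2.1] -/
theorem exists_pf_kernelH (w n : ℕ) (hw : 1 ≤ w) :
    ∃ c : ℕ → ℕ → ℚ,
      (∀ u : ℚ, (∀ m, m ≤ n → 2 * u + m + 1 ≠ 0) →
        BallRivoal.pfEval n w c (2 * u) = kernelH w n u) ∧
      BallRivoal.IsInt w (Nat.lcmUpto n) c ∧
      BallRivoal.l1 n w c ≤ (w.factorial : ℚ) *
        ∏ s ∈ Finset.range w, (2 : ℚ) ^ ((2 * s + 5) * n + 1) := by
  have hdiv : ∀ k : ℕ, 1 ≤ k → k ≤ n → (k : ℤ) ∣ (Nat.lcmUpto n : ℤ) :=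
    fun k h1 h2 => DilogPade.natCast_dvd_lcmUpto h1 h2
  obtain ⟨c, hc, hint, hl1⟩ :=
    BallRivoal.exists_pf_prod n (Nat.lcmUpto n) hdiv (resP n) w hw
  refine ⟨c, fun u hu => ?_, hint, hl1.trans ?_⟩
  · rw [hc (2 * u) hu, kernelH_eq_prod_brickEval w n u hu]
  · refine mul_le_mul_of_nonneg_left ?_ (by positivity)
    refine prod_le_prod (fun s _ => sum_nonneg fun _ _ => abs_nonneg _) fun s _ => ?_
    exact sum_abs_resP_le n s

end ParityPade

end Literature.NumberTheory.DiophantineApproximation
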